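import Summits.CriticalPhenomena.CardyFormulaZ2.Theorems.CardyComplexConeSLESixFamiliesGiveCardySmoothMarkFamiliesPart5
import HarnessLib

/-!
# Smooth-mark discretisation families, part 6: zone lemmas for the labelling

Helper file for stub `stub_smoothMarkFamilies` of line `collar-touch-sandwich` of crux
`SLESixFamiliesGiveCardy` (stmt-CriticalPhenomena-9654).  For the canonical discrete Dobrushin data
`⟨D.carrier, δ, ∅, ∅⟩` of a Dobrushin domain `D` which is a smooth epigraph near its mark `D.pt i`
(normalised frame data as in parts 2–5), three facts about boundary sites `x` and their NEAREST
frontier points feed the no-forcing and two-cut-edges conditions of the labelling reduction: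

* `not_shared_nearest`: two boundary sites near the mark in different frame columns never share a
  nearest frontier point (part 4's first-order obstruction + the staircase monotonicity of part 3);
* `voronoi_iff_column`: a boundary site near the mark but at distance `≥ 6δ` from it is strictly
  closer to the arc on its own side: the comparison `infDist arc 0 ≤ infDist arc 1` agrees with the
  frame-column test `⌊α/δ⌋ + 1 ≤ col x ↔ σ = 0`;
* `voronoi_of_nearest_far`: far from both marks, the comparison is decided by ANY nearest frontier
  point (no boundary site there has nearest points on both arcs, by the arc gap).
-/

noncomputable section

open Set Metric
open Literature.Probability Literature.Probability.RandomPlanarGeometry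
  Literature.Probability.LatticeModels Literature.Probability.Percolation

namespace Summit.CriticalPhenomena.CardyFormulaZ2.Cruxes.SLESixFamiliesGiveCardy.CollarTouchSandwich

namespace SmoothMark

section Zones

variable (D : DobrushinDomain) (i : Fin 2) {k : Fin 2} {s t : ℤ} {U V : ℂ} {G : ℝ → ℝ} {α R : ℝ}
  {σ : Fin 2} {δ : ℝ} {N : ℤ → ℤ}
  (hs : s = 1 ∨ s = -1) (ht : t = 1 ∨ t = -1)
  (hU : U = Site.toComplex (Pi.single k s)) (hV : V = Site.toComplex (Pi.single k.rev t))
  (hp : D.pt i = (α : ℂ) * U + ((G α : ℝ) : ℂ) * V)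
  (hmono : Monotone G) (hlip : ∀ a b, |G a - G b| ≤ |a - b|)
  (hepi : ∀ a b : ℝ, dist ((a : ℂ) * U + (b : ℂ) * V) (D.pt i) < R →
    ((a : ℂ) * U + (b : ℂ) * V ∈ D.carrier ↔ G a < b))
  (hdiff : ∀ c, |c - α| < R → DifferentiableAt ℝ G c)
  (hσp : ∀ c, α < c → dist ((c : ℂ) * U + ((G c : ℝ) : ℂ) * V) (D.pt i) < R →
    (c : ℂ) * U + ((G c : ℝ) : ℂ) * V ∈ D.arc σ ∧ (c : ℂ) * U + ((G c : ℝ) : ℂ) * V ∉ D.arc (σ + 1))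
  (hσm : ∀ c, c < α → dist ((c : ℂ) * U + ((G c : ℝ) : ℂ) * V) (D.pt i) < R →
    (c : ℂ) * U + ((G c : ℝ) : ℂ) * V ∈ D.arc (σ + 1) ∧ (c : ℂ) * U + ((G c : ℝ) : ℂ) * V ∉ D.arc σ)
  (hδ : 0 < δ) (hδR : 64 * δ ≤ R) (hN : ∀ j : ℤ, N j = ⌊G (δ * j) / δ⌋ + 1)
  (hbulk : ∀ x : Site 2, |δ * (s * x k) - α| ≤ R / 4 → 3 * R / 8 ≤ δ * (t * x k.rev) - G α →
    δ * (t * x k.rev) - G α ≤ R / 2 → x ∈ meshDomain D.carrier δ)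

include hs ht hU hV hp hmono hlip hepi hdiff hδ hδR hN hbulk in
/-- **No shared nearest frontier point across frame columns.** Two sites of the discrete boundary
near the mark with different frame columns have no common nearest frontier point. [folklore] -/
theorem not_shared_nearest {x y : Site 2}
    (hx : x ∈ (⟨D.carrier, δ, ∅, ∅⟩ : DiscreteDobrushin).zdBoundary)
    (hy : y ∈ (⟨D.carrier, δ, ∅, ∅⟩ : DiscreteDobrushin).zdBoundary)
    (hxp : dist (meshPoint δ x) (D.pt i) < R / 4 - 2 * δ) (hyp : dist (meshPoint δ y) (D.pt i) < R / 4 - 2 * δ)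
    {q : ℂ} (hq : q ∈ frontier D.carrier)
    (hqx : dist (meshPoint δ x) q = infDist (meshPoint δ x) (frontier D.carrier))
    (hqy : dist (meshPoint δ y) q = infDist (meshPoint δ y) (frontier D.carrier))
    (hlt : s * x k < s * y k) : False := by
  set E : DiscreteDobrushin := ⟨D.carrier, δ, ∅, ∅⟩ with hE
  have hδ' : 0 < E.δ := hδ
  have hδR' : 32 * E.δ ≤ R := by change 32 * δ ≤ R; linarith
  have hrow := row_le_row_of_col_lt (E := E) hs ht hU hV hp hδ' hδR' hmono hepi hbulk hN hx hy hxp hyp hlt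
  have hr : infDist (meshPoint δ x) (frontier D.carrier) ≤ 2 * δ :=
    infDist_frontier_le_of_mem_zdBoundary (E := E) D.isOpen hδ.le hx
  rw [meshPoint_eq_frame hs ht hU hV] at hqx hxp hr
  rw [meshPoint_eq_frame hs ht hU hV] at hqy
  refine not_nearest_of_lt_of_le hs ht hU hV hp D.isOpen hlip hepi hmono hdiff ?_ ?_ hq ?_ hqx hqy
  · have : (s : ℝ) * x k < s * y k := by exact_mod_cast hlt
    nlinarith
  · have : (t : ℝ) * x k.rev ≤ t * y k.rev := by exact_mod_cast hrow
    nlinarith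
  · rw [hqx]; linarith

/-- The frame-column test `⌊α / δ⌋ + 1 ≤ j` says `α < δ j` (`0 < δ`). [folklore] -/
theorem floor_add_one_le_iff {δ α : ℝ} (hδ : 0 < δ) (j : ℤ) : ⌊α / δ⌋ + 1 ≤ j ↔ α < δ * j := by
  rw [Int.add_one_le_iff, Int.floor_lt, div_lt_iff₀ hδ, mul_comm]

include hs ht hU hV hp hmono hlip hepi hσp hσm hδ hδR hN hbulk in
/-- **Voronoi comparison = column test, away from the mark.** For a boundary site near the mark but
at distance `≥ 6δ` from it, its frame column is far from that of the mark, all its nearest frontier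
points lie on the half-graph on its side, hence on one arc and off the other; so
`infDist arc 0 ≤ infDist arc 1` holds iff `⌊α/δ⌋ + 1 ≤ col x ↔ σ = 0`. [folklore] -/
theorem voronoi_iff_column {x : Site 2} (hx : x ∈ (⟨D.carrier, δ, ∅, ∅⟩ : DiscreteDobrushin).zdBoundary)
    (hxp : dist (meshPoint δ x) (D.pt i) < R / 4 - 2 * δ) (hfar : 6 * δ ≤ dist (meshPoint δ x) (D.pt i)) :
    infDist (meshPoint δ x) (D.arc 0) ≤ infDist (meshPoint δ x) (D.arc 1) ↔
      (⌊α / δ⌋ + 1 ≤ s * x k ↔ σ = 0) := by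
  set E : DiscreteDobrushin := ⟨D.carrier, δ, ∅, ∅⟩ with hE
  have hδ' : 0 < E.δ := hδ
  have hδR' : 32 * E.δ ≤ R := by change 32 * δ ≤ R; linarith
  obtain ⟨h1, h2⟩ := height_of_mem_zdBoundary (E := E) hs ht hU hV hp hδ' hδR' hmono hlip hepi hbulk hN hx hxp
  change 0 < δ * (t * x k.rev) - G (δ * (s * x k)) at h1
  change δ * (t * x k.rev) - G (δ * (s * x k)) ≤ 2 * δ at h2
  have hr : infDist (meshPoint δ x) (frontier D.carrier) ≤ 2 * δ :=
    infDist_frontier_le_of_mem_zdBoundary (E := E) D.isOpen hδ.le hx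
  set a : ℝ := δ * (s * x k) with ha
  set b : ℝ := δ * (t * x k.rev) with hb
  have hxab : meshPoint δ x = (a : ℂ) * U + (b : ℂ) * V := meshPoint_eq_frame hs ht hU hV δ x
  -- the column of `x` is far from that of the mark
  have haα : 3 * δ < |a - α| := by
    by_contra hle
    push Not at hle
    have hG := hlip a α
    have hbα : |b - G α| ≤ 5 * δ := by
      have : |b - G α| ≤ |b - G a| + |G a - G α| := abs_sub_le _ _ _
      rw [abs_of_pos h1] at this
      linarith
    have hd : dist (meshPoint δ x) (D.pt i) ^ 2 < (6 * δ) ^ 2 := by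
      rw [hxab, hp, dist_sq_frame hs ht hU hV]
      nlinarith [abs_nonneg (a - α), abs_nonneg (b - G α), sq_abs (a - α), sq_abs (b - G α)]
    have := abs_lt_of_sq_lt_sq hd (by positivity)
    rw [abs_of_nonneg dist_nonneg] at this
    linarith
  -- nearest frontier points are graph points on the side of `x`
  have hnear : ∀ q ∈ frontier D.carrier, dist (meshPoint δ x) q ≤ 2 * δ →
      ∃ c : ℝ, q = (c : ℂ) * U + ((G c : ℝ) : ℂ) * V ∧ |a - c| ≤ 2 * δ ∧ dist q (D.pt i) < R := by
    intro q hq hqd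
    rw [hxab] at hqd hxp
    obtain ⟨c, hc, hac, -⟩ := exists_param_of_frontier_near hs ht hU hV D.isOpen hlip hepi hq
      (by linarith : dist ((a : ℂ) * U + (b : ℂ) * V) (D.pt i) + dist ((a : ℂ) * U + (b : ℂ) * V) q < R)
    refine ⟨c, hc, hac.trans hqd, ?_⟩
    calc dist q (D.pt i) ≤ dist q ((a : ℂ) * U + (b : ℂ) * V) + dist ((a : ℂ) * U + (b : ℂ) * V) (D.pt i) :=
          dist_triangle _ _ _
      _ < 2 * δ + (R / 4 - 2 * δ) := by rw [dist_comm]; exact add_lt_add_of_le_of_lt hqd hxp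
      _ ≤ R := by linarith
  have hfne : (frontier D.carrier).Nonempty := ⟨_, D.pt_mem_frontier 0⟩
  obtain ⟨q, hq, hqd⟩ := isClosed_frontier.exists_infDist_eq_dist hfne (meshPoint δ x)
  have hqd' : dist (meshPoint δ x) q ≤ 2 * δ := hqd ▸ hr
  obtain ⟨c, rfl, hac, hcR⟩ := hnear q hq hqd'
  -- a nearest point of the other arc would also be a nearest frontier point
  have hother : ∀ j : Fin 2, (∀ q' ∈ frontier D.carrier, dist (meshPoint δ x) q' ≤ 2 * δ → q' ∉ D.arc j) →
      infDist (meshPoint δ x) (frontier D.carrier) < infDist (meshPoint δ x) (D.arc j) := by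
    intro j hj
    by_contra hle
    push Not at hle
    obtain ⟨q', hq', hq'd⟩ := (D.isCompact_arc j).exists_infDist_eq_dist ⟨_, D.pt_mem_arc_self j⟩ (meshPoint δ x)
    refine hj q' (D.arc_subset_frontier j hq') ?_ hq'
    rw [← hq'd]; exact hle.trans hr
  have hcol : ⌊α / δ⌋ + 1 ≤ s * x k ↔ α < a := by
    rw [floor_add_one_le_iff hδ]; push_cast; rw [ha]
  rcases lt_or_gt_of_ne (show a - α ≠ 0 by intro h; rw [h, abs_zero] at haα; linarith) with hlt | hgt
  · -- `x` is on the side `c < α`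
    have haα' : a < α - 3 * δ := by rw [abs_of_neg hlt] at haα; linarith
    have hside : ∀ q' ∈ frontier D.carrier, dist (meshPoint δ x) q' ≤ 2 * δ →
        q' ∈ D.arc (σ + 1) ∧ q' ∉ D.arc σ := by
      intro q' hq' hq'd
      obtain ⟨c', rfl, hac', hc'R⟩ := hnear q' hq' hq'd
      exact hσm c' (by linarith [(abs_le.1 hac').1]) hc'R
    have hA : infDist (meshPoint δ x) (D.arc (σ + 1)) ≤ infDist (meshPoint δ x) (frontier D.carrier) := by
      rw [hqd]; exact infDist_le_dist_of_mem (hside _ hq hqd').1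
    have hB := hother σ fun q' hq' hq'd => (hside q' hq' hq'd).2
    have hnc : ¬ (⌊α / δ⌋ + 1 ≤ s * x k) := by rw [hcol]; linarith
    obtain rfl | rfl : σ = 0 ∨ σ = 1 := by fin_cases σ <;> simp
    · rw [zero_add] at hA
      exact iff_of_false (fun h => absurd (hA.trans_lt hB) (not_lt.2 h)) (fun h => hnc (h.2 rfl))
    · have e : (1 : Fin 2) + 1 = 0 := rfl
      rw [e] at hA
      exact iff_of_true (hA.trans hB.le) (iff_of_false hnc (by decide))
  · -- `x` is on the side `α < c`
    have haα' : α + 3 * δ < a := by rw [abs_of_pos hgt] at haα; linarith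
    have hside : ∀ q' ∈ frontier D.carrier, dist (meshPoint δ x) q' ≤ 2 * δ →
        q' ∈ D.arc σ ∧ q' ∉ D.arc (σ + 1) := by
      intro q' hq' hq'd
      obtain ⟨c', rfl, hac', hc'R⟩ := hnear q' hq' hq'd
      exact hσp c' (by linarith [(abs_le.1 hac').2]) hc'R
    have hA : infDist (meshPoint δ x) (D.arc σ) ≤ infDist (meshPoint δ x) (frontier D.carrier) := by
      rw [hqd]; exact infDist_le_dist_of_mem (hside _ hq hqd').1
    have hB := hother (σ + 1) fun q' hq' hq'd => (hside q' hq' hq'd).2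
    have hc' : ⌊α / δ⌋ + 1 ≤ s * x k := by rw [hcol]; linarith
    obtain rfl | rfl : σ = 0 ∨ σ = 1 := by fin_cases σ <;> simp
    · rw [zero_add] at hB
      exact iff_of_true (hA.trans hB.le) (iff_of_true hc' rfl)
    · have e : (1 : Fin 2) + 1 = 0 := rfl
      rw [e] at hB
      exact iff_of_false (fun h => absurd (hA.trans_lt hB) (not_lt.2 h)) (fun h => absurd (h.1 hc') (by decide))

/-- **Far from the marks, the comparison is decided by any nearest frontier point.** If both arcs
are `c₀`-separated away from the marked points (`c₀ > 4δ`), a boundary site at distance `≥ ρ ≥ 4δ`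
from both marked points with a nearest frontier point `q` satisfies `infDist arc 0 ≤ infDist arc 1`
iff `q ∈ arc 0`. [folklore] -/
theorem voronoi_iff_of_nearest_far {δ ρ c₀ : ℝ} (hδ : 0 ≤ δ) (hρ : 4 * δ ≤ ρ) (hc₀ : 4 * δ < c₀)
    (hgap : ∀ j : Fin 2, ∀ z ∈ D.arc j, ρ / 2 ≤ dist z (D.pt 0) → ρ / 2 ≤ dist z (D.pt 1) →
      c₀ ≤ infDist z (D.arc (j + 1)))
    {x : Site 2} (hx : x ∈ (⟨D.carrier, δ, ∅, ∅⟩ : DiscreteDobrushin).zdBoundary)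
    (h0 : ρ ≤ dist (meshPoint δ x) (D.pt 0)) (h1 : ρ ≤ dist (meshPoint δ x) (D.pt 1))
    {q : ℂ} (hq : q ∈ frontier D.carrier)
    (hqx : dist (meshPoint δ x) q = infDist (meshPoint δ x) (frontier D.carrier)) :
    infDist (meshPoint δ x) (D.arc 0) ≤ infDist (meshPoint δ x) (D.arc 1) ↔ q ∈ D.arc 0 := by
  set E : DiscreteDobrushin := ⟨D.carrier, δ, ∅, ∅⟩ with hE
  have hr : infDist (meshPoint δ x) (frontier D.carrier) ≤ 2 * δ :=
    infDist_frontier_le_of_mem_zdBoundary (E := E) D.isOpen hδ hx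
  -- two nearest points on the two arcs contradict the arc gap
  have key : ∀ j : Fin 2, q ∈ D.arc (j + 1) →
      ¬ infDist (meshPoint δ x) (D.arc j) ≤ infDist (meshPoint δ x) (frontier D.carrier) := by
    intro j hqj hle
    obtain ⟨q', hq', hq'd⟩ := (D.isCompact_arc j).exists_infDist_eq_dist ⟨_, D.pt_mem_arc_self j⟩ (meshPoint δ x)
    have hd' : dist (meshPoint δ x) q' ≤ 2 * δ := by rw [← hq'd]; exact hle.trans hr
    have hd : dist (meshPoint δ x) q ≤ 2 * δ := by rw [hqx]; exact hr
    have hqq' : dist q' q ≤ 4 * δ := by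
      have := dist_triangle q' (meshPoint δ x) q
      rw [dist_comm q' (meshPoint δ x)] at this
      linarith
    have hfar : ∀ m : Fin 2, ρ ≤ dist (meshPoint δ x) (D.pt m) → ρ / 2 ≤ dist q' (D.pt m) := by
      intro m hm
      have := dist_triangle (meshPoint δ x) q' (D.pt m)
      linarith
    have := hgap j q' hq' (hfar 0 h0) (hfar 1 h1)
    have := infDist_le_dist_of_mem (x := q') hqj
    linarith
  have hq01 := (mem_frontier_iff_mem_arc D q).1 hq
  constructor
  · intro h
    by_contra hq0
    have hq1 : q ∈ D.arc 1 := hq01.resolve_left hq0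
    refine key 0 (by simpa using hq1) (h.trans ?_)
    rw [← hqx]; exact infDist_le_dist_of_mem hq1
  · intro hq0
    calc infDist (meshPoint δ x) (D.arc 0) ≤ dist (meshPoint δ x) q := infDist_le_dist_of_mem hq0
      _ = infDist (meshPoint δ x) (frontier D.carrier) := hqx
      _ ≤ infDist (meshPoint δ x) (D.arc 1) :=
          infDist_le_infDist_of_subset (D.arc_subset_frontier 1) ⟨_, D.pt_mem_arc_self 1⟩

end Zones

end SmoothMark

/-! ### Registered sub-goal (one-line signature, verbatim) -/

/-- **Registered sub-goal `smoothMark_part6` of `stub_smoothMarkFamilies`**: far from the marks the Voronoi comparison of the arcs is read off any nearest frontier point. [folklore] -/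
theorem smoothMark_part6 : ∀ (D : DobrushinDomain) (δ ρ c₀ : ℝ), 0 ≤ δ → 4 * δ ≤ ρ → 4 * δ < c₀ → (∀ j : Fin 2, ∀ z ∈ D.arc j, ρ / 2 ≤ dist z (D.pt 0) → ρ / 2 ≤ dist z (D.pt 1) → c₀ ≤ Metric.infDist z (D.arc (j + 1))) → ∀ x : Site 2, x ∈ (⟨D.carrier, δ, ∅, ∅⟩ : DiscreteDobrushin).zdBoundary → ρ ≤ dist (meshPoint δ x) (D.pt 0) → ρ ≤ dist (meshPoint δ x) (D.pt 1) → ∀ q ∈ frontier D.carrier, dist (meshPoint δ x) q = Metric.infDist (meshPoint δ x) (frontier D.carrier) → (Metric.infDist (meshPoint δ x) (D.arc 0) ≤ Metric.infDist (meshPoint δ x) (D.arc 1) ↔ q ∈ D.arc 0) :=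
  fun D _ _ _ hδ hρ hc₀ hgap _ hx h0 h1 _ hq hqx => SmoothMark.voronoi_iff_of_nearest_far D hδ hρ hc₀ hgap hx h0 h1 hq hqx

end Summit.CriticalPhenomena.CardyFormulaZ2.Cruxes.SLESixFamiliesGiveCardy.CollarTouchSandwich

end
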